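/-
Copyright (c) 2026. All rights reserved.
Released under Apache 2.0 license as described in the file LICENSE.
Authors: abc-iut cell, discharge seat abc-iut-L4-d3 (gen 9).
-/
import Literature.IUT.LogThetaLattice.HolomorphicLogShellVolume
import Literature.AnabelianGeometry.AbsoluteAnabelian.LogShellVolumesSchemaNegative
import HarnessLib

/-!
# [AbsTopIII] Cor 5.10 (i) — the cone node's closing theorem RE-CLOSED against the surviving instance
# form of F-0160 `LogShellFiniteVolume` (zero FACT binders; the binder is moreover removable)

S. Mochizuki, *Topics in absolute anabelian geometry III: global reconstruction algorithms*, J. Math. Sci.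
Univ. Tokyo 22 (2015) 939–1156 [MochizukiAbsTopIII2015], Cor 5.10 (i), manuscript p. 147 (lit key
`paper:url-5493eb38cbb7`):

  "(i) (Finite Log-volume) Let `v ∈ V(F_mod)^non` (respectively, `v ∈ V(F_mod)^arc`). For each
   •-shell-container `S ∈ Ob(𝒩⊞_v)`, `S^Gal` is equipped with a well-defined log-volume (respectively,
   well-defined radial and angular log-volumes) [cf. Definition 5.9, (ii)] that depend(s) only on the
   •-shell-container structure of `S`. Moreover, the •-log-shell is contained in `S^Gal` and [relative
   to these log-volumes] is of finite log-volume (respectively, finite radial log-volume)."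
  (verbatim, manuscript p. 147 l. 14–20; proof p. 149 l. 1–2: "The various assertions of Corollary 5.10
  are immediate from the definitions, together with the references quoted in the statement".)

READING (the tree's, NOT print's wording — docstring re-quoted verbatim 2026-08-27 after abc-iut-w6-d025's
and abc-iut-w6-d022's RQ7 reads flagged the earlier header as a paraphrase inside quotation marks):
abc-iut-L4-t3 typed the nonarchimedean clause "is of finite log-volume" as the predicate
`LogShellFiniteVolume L` (`ℐ ∈ M(k)`) and recorded the consequence `0 ≤ μ_k^log(ℐ)` of Def 5.4 (iii)'s
`𝒪_k ⊆ ℐ` (p. 126) and the normalisation `μ_k(𝒪_k) = 1` (Prop 5.7 (i)(a)(3) p. 137) as the closing theorem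
`localLogVolume_logShell_nonneg`; "immediate from the definitions" unfolds, for the `p_k`-adic logarithm,
to: `log_k` is a continuous homomorphism on the compact group `𝒪_k^×` with open image, so `ℐ` is compact
open and the normalised Haar measure applies — the structural inputs of §1 below.

PROOF-ONLY companion (no definition, no instance, no notation, no named fact; abc-iut cell, seat
abc-iut-L4-d3 gen 9, L4-lead m147 (7) row «K4 RE-CLOSE AbsTopIII:Cor5.10(i)») for the kernel DAG node
`AbsTopIII:Cor5.10(i)` (`Summits/ABC/IUTFork/DAGL4u.lean`, `N_AbsTopIII_Cor5_10_i` = the conjunction of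
the statements of `localLogVolume_logShell_nonneg`, `archLogShell_mem_radialAdmissible`,
`radialVolume_archLogShell` of abc-iut-L4-t3's `LogShellVolumes.lean`).  The FIRST of these closing
theorems takes the FACT-LIST row **F-0160** (`LogShellFiniteVolume L`, "`ℐ ∈ M(k)`", class
"universal-closure REFUTED / schema": `not_forall_logShellFiniteVolume`, abc-iut-w5-d182's
`LogShellVolumesSchemaNegative.lean` — the hypothesis structure `PadicLogOnUnits K` records only the
bijection `1 + p*𝒪 ≅ p*𝒪`, so a junk `log` elsewhere on `𝒪^×` can make `ℐ` non-open) AS ITS BINDER `h`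
and returns `0 ≤ μ_k^log(ℐ)`.  abc-iut-c312-2's K-census (CONE-K4-RECLOSE v4, 815a6b69de7cfeb3) classes the
node PH-INHABITED: the binder is inhabited at the genuine carrier `PadicLogOnUnits.ofUnitLog p K` (THE
`p`-adic logarithm of a `p`-adic field `K`, abc-iut-L3-t11) by the CLOSED producer
`Literature.IUT.LogThetaLattice.logShellFiniteVolume_ofUnitLog` (abc-iut-L6-d2), but no theorem yet
concluded the node with the binder discharged.  This file RE-CLOSES it:

* §1 THE BINDER IS REMOVABLE: `localLogVolume_nonneg_of_closedBall_subset` /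
  `localLogVolume_logShell_nonneg'` — `0 ≤ μ_k^log(ℐ(L))` for EVERY `L : PadicLogOnUnits K`, no
  hypothesis.  Honest reading: where `ℐ` has finite Haar measure this is the printed argument
  `𝒪_k ⊆ ℐ ⇒ μ(ℐ) ≥ μ(𝒪_k) = 1`; where the measure is infinite the tree's real-valued `localVolume` takes
  Mathlib's junk value `(⊤ : ℝ≥0∞).toReal = 0` and `Real.log 0 = 0`, so the inequality is content-free there
  — the CONTENT of Cor 5.10 (i) ("finite positive log-volume") is the row F-0160 itself, supplied in §2.
* §1 CLOSED PRODUCERS of F-0160 from print's STRUCTURAL inputs only (hypotheses on the datum `log_k`, not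
  FACT rows): `isOpen_preLogShell_of_mul` — if `log_k(x·y) = log_k x + log_k y` for `x ∈ 𝒪^×` and
  `y ∈ 1 + p*𝒪` then `log_k(𝒪^×) = ⋃_x (log_k x + p*𝒪)` is open; `logShellFiniteVolume_of_continuousOn_of_isOpen`
  / `logShellFiniteVolume_of_continuousOn_of_mul` — continuity of `log_k` on the compact `𝒪^×`
  (abc-iut-L6-t3's `isCompact_logShell`) + openness ⇒ `ℐ ∈ M(k)`; these are exactly the two properties
  of "the `p_k`-adic logarithm" the printed proof uses.
* §2 ZERO-BINDER INSTANCES at the genuine carrier of record: for every prime `p` and every `p`-adic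
  field `K` (`[NormedAlgebra ℚ_[p] K] [IsUltrametricDist K] [ProperSpace K]`), at
  `L := PadicLogOnUnits.ofUnitLog p K`: the structural inputs HOLD (`ofUnitLog_structuralInputs`: abc-iut-S1's
  `continuousOn_unitLog`, `unitLog_mul`), F-0160 holds (by the producer of record AND, independently, by
  §1's generic producer — last conjunct of `ofUnitLog_structuralInputs`), `μ_K(ℐ_K) > 0`, `μ_K^log(ℐ_K) ≥ 0` with the
  binder DISCHARGED (`localLogVolume_logShell_ofUnitLog_nonneg`), and the whole node content
  nonarchimedean + archimedean in one display (`cor510i_reclosed_ofUnitLog`).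
* §3 `logShellFiniteVolume_independent` — HONEST STATUS: at every such `K` the row HOLDS at the
  `p`-adic logarithm and FAILS at some junk `PadicLogOnUnits K` datum (abc-iut-w5-d182's
  `exists_not_logShellFiniteVolume`), while the node's inequality holds at both; so F-0160 stays
  consumable at NAMED instances only, exactly as the FACT-policy ruling says — nothing here moves the
  row's label, and the node stays FACT-policy for the count (re-closed ≠ discharged).

HONEST FRAMING.  "Re-closed" = OUR kernel theorems with no assumption-class binder, at the carrier the
tree constructs; here that carrier (`log_p` on `𝒪_K^×` of a finite extension `K/ℚ_p`, abc-iut-S1) IS the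
object print speaks of, not a toy; for finite `E ⊆ ℚ̄_p` it is moreover identified with `(p*)⁻¹ ·` the
pre-log-shell of the GALOIS-side logarithm `log_k̄` of [AbsTopIII] Def 3.1 (iv) by abc-iut-L6-d2's
`pstar_inv_smul_preLogShell_ofPadicSubfield` (`GaloisPadicLogShellBridge.lean`, cited by name, not
imported), so the re-close is a statement about the group-theoretically indexed log-shell as well.  [AbsTopIII] is a refereed, undisputed paper; nothing in this file
bears on [IUTchIII] Cor. 3.12 or takes a side on any author; typed ≠ proved elsewhere; re-closed ≠
endorsed.
-/

set_option autoImplicit false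

noncomputable section

namespace Literature.AnabelianGeometry.AbsoluteAnabelian

open MeasureTheory Set Metric
open scoped Pointwise ENNReal Real
open Literature.IUT.LogThetaLattice (isCompact_logShell logShellFiniteVolume_ofUnitLog
  continuousOn_log_ofUnitLog)

/-! ## §1 The closer without its binder; closed producers of F-0160 from structural inputs -/

section Generic

variable {K : Type*} [NontriviallyNormedField K] [IsUltrametricDist K] [ProperSpace K]

omit [ProperSpace K] in
/-- **Print's openness input, from homomorphy** (CLOSED producer of the openness half of F-0160): if
`log_k (x·y) = log_k x + log_k y` for `x ∈ 𝒪_k^×` and `y ∈ 1 + p*·𝒪_k`, then the pre-log-shell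
`ℐ* = log_k(𝒪_k^×)` is the union over `x ∈ 𝒪_k^×` of the translates `log_k x + p*·𝒪_k` of the open ball
`p*·𝒪_k = log_k(1 + p*·𝒪_k)` (Def 5.4 (iii)), hence OPEN. [cite: MochizukiAbsTopIII2015, Cor 5.10 (i) p. 147] -/
theorem isOpen_preLogShell_of_mul (L : PadicLogOnUnits K)
    (hmul : ∀ x ∈ sphere (0 : K) 1, ∀ y ∈ closedBall (1 : K) ‖L.pstar‖,
      L.log (x * y) = L.log x + L.log y) :
    IsOpen (preLogShell L) := by
  have hr : (0 : ℝ) < ‖L.pstar‖ := norm_pos_iff.mpr L.pstar_ne_zero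
  rw [isOpen_iff_forall_mem_open]
  rintro _ ⟨x, hx, rfl⟩
  refine ⟨(fun z => L.log x + z) '' closedBall (0 : K) ‖L.pstar‖, ?_, ?_, ?_⟩
  · rintro _ ⟨z, hz, rfl⟩
    rw [← L.image_principalUnits] at hz
    obtain ⟨y, hy, rfl⟩ := hz
    refine ⟨x * y, ?_, hmul x hx y hy⟩
    have hx1 : ‖x‖ = 1 := by simpa using hx
    have hy1 : ‖y‖ = 1 := by simpa using closedBall_one_subset_sphere L hy
    simp [norm_mul, hx1, hy1]
  · exact (isOpenMap_add_left (L.log x)) _ (IsUltrametricDist.isOpen_closedBall (0 : K) hr.ne')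
  · exact ⟨0, mem_closedBall_self hr.le, add_zero _⟩

/-- **F-0160 from print's structural inputs, ZERO fact binders** (generic CLOSED producer): if `log_k` is
continuous on the (compact) unit sphere `𝒪_k^×` of the proper field `k` and `ℐ* = log_k(𝒪_k^×)` is open,
then the log-shell `ℐ = (p*)⁻¹·ℐ*` is a nonempty (`0 ∈ 𝒪_k ⊆ ℐ`, Def 5.4 (iii)) compact (abc-iut-L6-t3's
`isCompact_logShell`) open subset of `k`, i.e. `ℐ ∈ M(k)` — "of finite log-volume".
[cite: MochizukiAbsTopIII2015, Cor 5.10 (i) p. 147] -/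
theorem logShellFiniteVolume_of_continuousOn_of_isOpen (L : PadicLogOnUnits K)
    (hcont : ContinuousOn L.log (sphere (0 : K) 1)) (hopen : IsOpen (preLogShell L)) :
    LogShellFiniteVolume L :=
  ⟨⟨0, closedBall_subset_logShell L (mem_closedBall_self zero_le_one)⟩, isCompact_logShell L hcont,
    hopen.smul₀ (inv_ne_zero L.pstar_ne_zero)⟩

/-- **F-0160 from "the `p_k`-adic logarithm is a continuous homomorphism on `𝒪_k^×`"** (generic CLOSED
producer, the printed proof's two inputs): continuity on `𝒪_k^×` and `log_k(x·y) = log_k x + log_k y`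
(`x ∈ 𝒪_k^×`, `y ∈ 1 + p*·𝒪_k`) give `ℐ ∈ M(k)`. [cite: MochizukiAbsTopIII2015, Cor 5.10 (i) p. 147] -/
theorem logShellFiniteVolume_of_continuousOn_of_mul (L : PadicLogOnUnits K)
    (hcont : ContinuousOn L.log (sphere (0 : K) 1))
    (hmul : ∀ x ∈ sphere (0 : K) 1, ∀ y ∈ closedBall (1 : K) ‖L.pstar‖,
      L.log (x * y) = L.log x + L.log y) :
    LogShellFiniteVolume L :=
  logShellFiniteVolume_of_continuousOn_of_isOpen L hcont (isOpen_preLogShell_of_mul L hmul)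

variable [MeasurableSpace K] [BorelSpace K]

/-- **The inequality of Cor 5.10 (i) for ANY subset containing `𝒪_k`, no hypothesis**: `0 ≤ μ_k^log(A)`
whenever `𝒪_k ⊆ A`.  If `μ_k(A) < ∞` this is print's `μ_k(A) ≥ μ_k(𝒪_k) = 1`; if the Haar measure of `A`
is infinite, the tree's real-valued volume `localVolume K A = (localHaar K A).toReal` is Mathlib's junk
value `0` and `Real.log 0 = 0` (documented at `localVolume`), so the inequality holds content-free.
[cite: MochizukiAbsTopIII2015, Cor 5.10 (i) p. 147] -/
theorem localLogVolume_nonneg_of_closedBall_subset {A : Set K} (hA : closedBall (0 : K) 1 ⊆ A) :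
    0 ≤ localLogVolume K A := by
  unfold localLogVolume localVolume
  rcases eq_or_ne (localHaar K A) ∞ with h | h
  · rw [h, ENNReal.toReal_top, Real.log_zero]
  · apply Real.log_nonneg
    have h1 : (localHaar K (closedBall (0 : K) 1)).toReal ≤ (localHaar K A).toReal :=
      ENNReal.toReal_mono h (measure_mono hA)
    rwa [localHaar_closedBall_one, ENNReal.toReal_one] at h1

/-- **The node's closer WITHOUT its F-0160 binder**: for EVERY `p`-adic-logarithm datum `L`,
`0 ≤ μ_k^log(ℐ(L))` — abc-iut-L4-t3's `localLogVolume_logShell_nonneg L h` holds verbatim with the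
hypothesis `h : LogShellFiniteVolume L` deleted (from `𝒪_k ⊆ ℐ`, `closedBall_subset_logShell`, and the
previous lemma; see its docstring for the junk-value reading off `M(k)`).  K4 bookkeeping: the binder is
REMOVABLE for this conjunct of `N_AbsTopIII_Cor5_10_i`; the content "finite positive volume" is F-0160
itself (§2). [cite: MochizukiAbsTopIII2015, Cor 5.10 (i) p. 147] -/
theorem localLogVolume_logShell_nonneg' (L : PadicLogOnUnits K) : 0 ≤ localLogVolume K (logShell L) :=
  localLogVolume_nonneg_of_closedBall_subset (closedBall_subset_logShell L)

/-- The binder form and the binder-free form agree (the F-0160 hypothesis of the closer is idle for its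
conclusion). [cite: MochizukiAbsTopIII2015, Cor 5.10 (i) p. 147] -/
theorem localLogVolume_logShell_nonneg_eq (L : PadicLogOnUnits K) (h : LogShellFiniteVolume L) :
    localLogVolume_logShell_nonneg L h = localLogVolume_logShell_nonneg' L := rfl

/-- Under print's structural inputs the log-shell has POSITIVE finite volume `μ_k(ℐ) > 0` (so its
log-volume is a genuine real number `log μ_k(ℐ) ≥ 0`, not a junk value).
[cite: MochizukiAbsTopIII2015, Cor 5.10 (i) p. 147] -/
theorem localVolume_logShell_pos_of_continuousOn_of_mul (L : PadicLogOnUnits K)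
    (hcont : ContinuousOn L.log (sphere (0 : K) 1))
    (hmul : ∀ x ∈ sphere (0 : K) 1, ∀ y ∈ closedBall (1 : K) ‖L.pstar‖,
      L.log (x * y) = L.log x + L.log y) :
    0 < localVolume K (logShell L) ∧ localHaar K (logShell L) < ∞ ∧ 0 ≤ localLogVolume K (logShell L) :=
  ⟨localVolume_pos (logShellFiniteVolume_of_continuousOn_of_mul L hcont hmul),
    localHaar_lt_top_of_mem (logShellFiniteVolume_of_continuousOn_of_mul L hcont hmul),
    localLogVolume_logShell_nonneg' L⟩

end Generic

/-! ## §2 Zero-binder instances at the genuine carrier: THE `p`-adic logarithm of a `p`-adic field -/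

section Standard

open Literature.IUT.LogVolume (unitLog unitLog_mul)

variable (p : ℕ) [Fact p.Prime]
variable (K : Type*) [NontriviallyNormedField K] [NormedAlgebra ℚ_[p] K] [IsUltrametricDist K]
  [ProperSpace K]

/-- **Print's structural inputs HOLD for the `p`-adic logarithm** `L := PadicLogOnUnits.ofUnitLog p K`
(abc-iut-L3-t11's standard model over abc-iut-S1's `unitLog = log_p`): `log_p` is continuous on `𝒪_K^×`
(`continuousOn_unitLog`) and a homomorphism there (`unitLog_mul`; `1 + p*𝒪_K ⊆ 𝒪_K^×`) — and hence, by
the GENERIC producer of §1 (independently of the producer of record `logShellFiniteVolume_ofUnitLog`),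
F-0160 holds: `ℐ_K ∈ M(K)`. [cite: MochizukiAbsTopIII2015, Cor 5.10 (i) p. 147] -/
theorem ofUnitLog_structuralInputs :
    (ContinuousOn (PadicLogOnUnits.ofUnitLog p K).log (sphere (0 : K) 1) ∧
      ∀ x ∈ sphere (0 : K) 1, ∀ y ∈ closedBall (1 : K) ‖(PadicLogOnUnits.ofUnitLog p K).pstar‖,
        (PadicLogOnUnits.ofUnitLog p K).log (x * y) =
          (PadicLogOnUnits.ofUnitLog p K).log x + (PadicLogOnUnits.ofUnitLog p K).log y) ∧
      LogShellFiniteVolume (PadicLogOnUnits.ofUnitLog p K) := by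
  have hcont := continuousOn_log_ofUnitLog p K
  have hmul : ∀ x ∈ sphere (0 : K) 1, ∀ y ∈ closedBall (1 : K) ‖(PadicLogOnUnits.ofUnitLog p K).pstar‖,
      (PadicLogOnUnits.ofUnitLog p K).log (x * y) =
        (PadicLogOnUnits.ofUnitLog p K).log x + (PadicLogOnUnits.ofUnitLog p K).log y := by
    intro x hx y hy
    have hx1 : ‖x‖ = 1 := by simpa using hx
    have hy1 : ‖y‖ = 1 := by simpa using closedBall_one_subset_sphere _ hy
    rw [PadicLogOnUnits.ofUnitLog_log]
    exact unitLog_mul p hx1 hy1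
  exact ⟨⟨hcont, hmul⟩, logShellFiniteVolume_of_continuousOn_of_mul _ hcont hmul⟩

variable [MeasurableSpace K] [BorelSpace K]

/-- **The node's closer RE-CLOSED at the genuine carrier, binder DISCHARGED by the producer of record**:
`0 ≤ μ_K^log(ℐ_K)` for the log-shell of the `p`-adic logarithm of ANY `p`-adic field `K`, obtained as
`localLogVolume_logShell_nonneg _ (logShellFiniteVolume_ofUnitLog p K)` — zero FACT binders.
[cite: MochizukiAbsTopIII2015, Cor 5.10 (i) p. 147] -/
theorem localLogVolume_logShell_ofUnitLog_nonneg :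
    0 ≤ localLogVolume K (logShell (PadicLogOnUnits.ofUnitLog p K)) :=
  localLogVolume_logShell_nonneg _ (logShellFiniteVolume_ofUnitLog p K)

/-- `μ_K(ℐ_K) > 0` and `μ_K(ℐ_K) < ∞` at the `p`-adic logarithm: the log-volume of Cor 5.10 (i) is a
genuine real number here (no junk value enters). [cite: MochizukiAbsTopIII2015, Cor 5.10 (i) p. 147] -/
theorem localVolume_logShell_ofUnitLog_pos :
    0 < localVolume K (logShell (PadicLogOnUnits.ofUnitLog p K)) ∧
      localHaar K (logShell (PadicLogOnUnits.ofUnitLog p K)) < ∞ :=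
  ⟨localVolume_pos (logShellFiniteVolume_ofUnitLog p K),
    localHaar_lt_top_of_mem (logShellFiniteVolume_ofUnitLog p K)⟩

/-- **[AbsTopIII] Cor 5.10 (i) — the kernel node `N_AbsTopIII_Cor5_10_i` RE-CLOSED with ZERO assumption-class
binders**, all conjuncts in one display: nonarchimedean, at the `p`-adic logarithm of any `p`-adic field
`K` — `ℐ_K ∈ M(K)` (F-0160 SUPPLIED, not assumed), `0 < μ_K(ℐ_K)`, `0 ≤ μ_K^log(ℐ_K)` (the first closing
theorem's conclusion); archimedean (abc-iut-L4-t3, already hypothesis-free) — `ℐ = closedBall 0 π ∈ M(ℂ)`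
radially and `μ(ℐ) = π`. [cite: MochizukiAbsTopIII2015, Cor 5.10 (i) p. 147] -/
theorem cor510i_reclosed_ofUnitLog :
    LogShellFiniteVolume (PadicLogOnUnits.ofUnitLog p K) ∧
      0 < localVolume K (logShell (PadicLogOnUnits.ofUnitLog p K)) ∧
      0 ≤ localLogVolume K (logShell (PadicLogOnUnits.ofUnitLog p K)) ∧
      ComplexLogShell.logShell ∈ ComplexVolume.radialAdmissible ∧
      ComplexVolume.radialVolume ComplexLogShell.logShell = π :=
  ⟨logShellFiniteVolume_ofUnitLog p K, (localVolume_logShell_ofUnitLog_pos p K).1,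
    localLogVolume_logShell_ofUnitLog_nonneg p K, archLogShell_mem_radialAdmissible,
    radialVolume_archLogShell⟩

/-! ## §3 Honest status of F-0160 among the inhabitants of `PadicLogOnUnits K` -/

/-- **F-0160 takes BOTH truth values over `PadicLogOnUnits K` at every `p`-adic field `K`, while the
node's inequality holds throughout**: the row HOLDS at the `p`-adic logarithm (`ofUnitLog p K`) and FAILS
at abc-iut-w5-d182's junk datum (`exists_not_logShellFiniteVolume`: `log := x ↦ x − 1` on `1 + ϖ²𝒪`,
junk `1` elsewhere, `ℐ = 𝒪 ∪ {ϖ⁻²}` not open), and `0 ≤ μ_K^log(ℐ)` holds at both.  The row is a schema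
consumable at NAMED instances; this file supplies the instance of record, it does not move the label.
[cite: MochizukiAbsTopIII2015, Cor 5.10 (i) p. 147] -/
theorem logShellFiniteVolume_independent :
    (LogShellFiniteVolume (PadicLogOnUnits.ofUnitLog p K) ∧
        0 ≤ localLogVolume K (logShell (PadicLogOnUnits.ofUnitLog p K))) ∧
      ∃ L : PadicLogOnUnits K, ¬ LogShellFiniteVolume L ∧ 0 ≤ localLogVolume K (logShell L) := by
  refine ⟨⟨logShellFiniteVolume_ofUnitLog p K, localLogVolume_logShell_ofUnitLog_nonneg p K⟩, ?_⟩
  obtain ⟨L, hL⟩ := exists_not_logShellFiniteVolume (K := K)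
  exact ⟨L, hL, localLogVolume_logShell_nonneg' L⟩

end Standard

end Literature.AnabelianGeometry.AbsoluteAnabelian

end
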